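import Summits.QuantumFields.YangMills.Theses.LuscherReduction
import Summits.QuantumFields.YangMills.Theorems.LuscherReductionTraceDoorDefs
import HarnessLib

/-!
# Sketch (g1) — crux-ideate #2 (round 1), third card `action-domination-sandwich`
on `LuscherReduction.TwistedTraceScaling` (stmt-QuantumFields-20203)

STATEMENTS ONLY (`Prop` definitions) plus ONE elementary proved brick (`integral_exp_sandwich`, the «sandwich»:
two-sided pointwise domination of one action by another, modulo a constant, gives two-sided bounds of the partition
functions by coupling-shifted partition functions).  Nothing else is asserted or proved; no skeleton at this stage.

* `TowerCauchyE1 q`  — the trace-level OUTPUT of the card's two RG-side stubs (α DOMINATED BLOCKING + σ SANDWICH):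
  an ANCHORED CAUCHY PROPERTY of the dyadic trace ratio along Bałaban towers — every lattice `L ≥ M²` deep in the femto
  window is `ε`-close (in trace ratio, at matched two-loop label) to every regular tower member `L₁ = b·M^j` below it whose
  size is at least `lam^{-q}` (the anchor must GROW: the tree-level `(b/L₁)²` blocking-artefact mismatch is charged at full
  equipartition `≈ 4.5·s·b⁴/Λ`, so a fixed anchor costs `s b⁶/(L₁² Λ) → ∞`; `q > 1/2` makes it `→ 0`).
* `PolyDeepTraceLaw p` — stub π: the femto trace law at POLYNOMIAL DEPTH `β ≥ L^p`, uniformly in the lattice size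
  (strictly between the registered fixed-lattice S-BASE and the uniform window law UFTL; for `p > 3` the regime is
  naive-perturbative: `dimension × coupling ≈ 18·L^{3−p} → 0`).
* `AnchoredComposition q p` — the bookkeeping implication `TowerCauchyE1 q → PolyDeepTraceLaw p → TTS` (valid choice of
  exponents: `1/2 < q`, `p·q < 3`, e.g. `q = 11/20`, `p = 5`; the anchor `L₁ ∈ [lam^{-q}, (8 lam³)^{-1/p}] ∩ b·M^ℕ` exists deep
  in the window and its matched coupling is `≥ L₁^p` automatically).

HONEST FRAMING: stub-level material for a child (TTS) of the CONDITIONAL reduction route `LuscherReduction`; femto rung R2b1;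
not infinite volume, not a gap, not Clay.  The RG-side stub α (pointwise two-sided domination of Bałaban-blocked actions of two
fine Wilson theories on a common coarse lattice) is NOT typeable today (no block-averaging kernel for lattice gauge fields in the
tree) and is described in words on the card.
-/

set_option autoImplicit false

noncomputable section

open MeasureTheory Filter Topology Real
open Literature.MathematicalPhysics.QuantumFieldTheory
open Literature.MathematicalPhysics.QuantumLattice
open Summit.QuantumFields.YangMills.Theorems.FemtoTransferGap
open Summit.QuantumFields.YangMills.Theorems.FemtoTransferGap.TraceDoor (traceRatio femtoSteps hTraceRatio)

namespace Summit.QuantumFields.YangMills.Cruxes.TwistedTraceScaling.Ideate2g1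

/-! ## σ — the sandwich brick (elementary, PROVED): action domination ⇒ partition-function domination -/

/-- **Sandwich.** If `|S − S' − c| ≤ K·A` pointwise, then
`e^{−c} ∫ e^{−(S' + K A)} ≤ ∫ e^{−S} ≤ e^{−c} ∫ e^{−(S' − K A)}`:
the partition function of `S` is squeezed between the coupling-SHIFTED partition functions of `S'`, up to the common
factor `e^{−c}` (which cancels in every dyadic ratio `Z(2T)/Z(T)²` as soon as `c` is additive in `T`).  With `A ≥ 0` the
action (`S' = β A + loop terms`) the shift is `β ↦ β ± K`; log-convexity of `t ↦ log ∫ e^{−(S' + tA)}` then bounds the width of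
the squeeze by `2K·⟨A⟩_{β−K}` — small whenever the TOTAL action budget `K⟨A⟩` is small (sub-critical coarse 4-volume). -/
theorem integral_exp_sandwich {X : Type*} [MeasurableSpace X] (μ : Measure X) {S S' A : X → ℝ} {K c : ℝ}
    (hdom : ∀ x, |S x - S' x - c| ≤ K * A x)
    (hS : Integrable (fun x => exp (-S x)) μ)
    (hlo : Integrable (fun x => exp (-(S' x + K * A x))) μ)
    (hhi : Integrable (fun x => exp (-(S' x - K * A x))) μ) :
    exp (-c) * ∫ x, exp (-(S' x + K * A x)) ∂μ ≤ ∫ x, exp (-S x) ∂μ ∧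
      ∫ x, exp (-S x) ∂μ ≤ exp (-c) * ∫ x, exp (-(S' x - K * A x)) ∂μ := by
  constructor
  · rw [← integral_const_mul]
    refine integral_mono (hlo.const_mul _) hS fun x => ?_
    have h := (abs_le.1 (hdom x)).2
    dsimp only
    rw [← Real.exp_add]
    exact Real.exp_le_exp.2 (by linarith)
  · rw [← integral_const_mul]
    refine integral_mono hS (hhi.const_mul _) fun x => ?_
    have h := (abs_le.1 (hdom x)).1
    dsimp only
    rw [← Real.exp_add]
    exact Real.exp_le_exp.2 (by linarith)

/-! ## The trace-level output of α + σ: an anchored Cauchy property along Bałaban towers -/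

/-- **TowerCauchyE1 q** (output of stubs α DOMINATED BLOCKING + σ SANDWICH; E1 geometry of the registered line «twolattice» r2):
for every femto time `s` and precision `ε` there are a block factor `M ≥ 2` and a depth `lam0` such that, deep in the femto window,
every lattice `L ≥ M²` with its E1 landing `b·M^{k+1} ≤ L < b·M^k·(M+1)` (`b ∈ [M, M²)`) has its dyadic trace ratio at
`T = ⌈sL/Λ⌉` within `ε` of that of EVERY regular tower member `L₁ = b·M^j`, `j ≤ k`, of size at least `lam^{−q}`, at the coarse
coupling `β₁ ≥ 1` with the same two-loop label (`invRunningCoupling β₁ L₁ = invRunningCoupling β L`).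
Compared with the registered S-TOWER/TOWER-E1 the partner is a GROWING anchor, not the fixed base `b`: the base carries no law. -/
def TowerCauchyE1 (q : ℝ) : Prop :=
  ∀ s : ℝ, 0 < s → ∀ ε : ℝ, 0 < ε → ∃ M : ℕ, 2 ≤ M ∧ ∃ lam0 : ℝ, 0 < lam0 ∧ ∀ lam : ℝ, 0 < lam → lam ≤ lam0 →
    ∀ (L : ℕ) [NeZero L], M ^ 2 ≤ L → ∀ β : ℝ, InFemtoWindow lam β L →
      ∀ (b k j : ℕ) [NeZero b], M ≤ b → b < M ^ 2 → b * M ^ (k + 1) ≤ L → L < b * M ^ k * (M + 1) → j ≤ k →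
        ∀ (L₁ : ℕ) [NeZero L₁], L₁ = b * M ^ j → lam ^ (-q) ≤ (L₁ : ℝ) →
          ∀ β₁ : ℝ, 1 ≤ β₁ → invRunningCoupling β₁ L₁ = invRunningCoupling β L →
            |traceRatio L β (femtoSteps s β L) - traceRatio L₁ β₁ (femtoSteps s β₁ L₁)| ≤ ε

/-! ## π — the femto trace law at polynomial depth -/

/-- **PolyDeepTraceLaw p** (stub π): for every femto time `s` and precision `ε` there is `Λ⋆ > 0` such that on EVERY lattice `L`,
at every coupling of polynomial depth `β ≥ L^p` whose Lüscher parameter is genuine (`0 < invRunningCoupling β L`) and small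
(`Λ(β,L) ≤ Λ⋆`), the dyadic trace ratio at `⌈sL/Λ⌉` steps is `ε`-close to Lüscher's `r_𝔥(s)`.
Uniform in `L`, but only at polynomial depth: for `p > 3` the anharmonic couplings satisfy `dimension × coupling → 0`
(single-scale, union bound beats entropy; no renormalisation group).  The line uses `p = 5` (any `p` with `3 < p < 3/q`). -/
def PolyDeepTraceLaw (p : ℝ) : Prop :=
  ∀ s : ℝ, 0 < s → ∀ ε : ℝ, 0 < ε → ∃ Λstar : ℝ, 0 < Λstar ∧
    ∀ (L : ℕ) [NeZero L], ∀ β : ℝ, (L : ℝ) ^ p ≤ β → 0 < invRunningCoupling β L → luscherLambda β L ≤ Λstar →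
      |traceRatio L β (femtoSteps s β L) - hTraceRatio s| ≤ ε

/-! ## Composition (bookkeeping, stated): anchored Cauchy + poly-deep identification ⇒ TTS -/

/-- **AnchoredComposition q p**: for exponents with `1/2 < q` and `p·q < 3` the two statements above imply the crux
(`TraceDoor`: `TTS ⟸ |r_L − r_𝔥| small ∧ OSTL`, OSTL closed p520508): given `(s, ε)`, take `M, lam0` from `TowerCauchyE1 q`
at `ε/3` and `Λ⋆` from `PolyDeepTraceLaw p` at `ε/3`; deep in the window (`2·lam ≤ Λ⋆`, `lam^{3/p − q} ≤ 8^{−1/p}/M`) the anchor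
`L₁ = b·M^j ∈ [lam^{−q}, (8 lam³)^{−1/p}]` exists, its matched coupling satisfies `β₁ ≥ invRunningCoupling β L ≥ (2 lam)^{−3} ≥ L₁^p`,
and the triangle `r_L ~ r_{L₁} ~ r_𝔥(s) ~ r_1(B)` closes with `L0 := M²`. -/
def AnchoredComposition (q p : ℝ) : Prop :=
  TowerCauchyE1 q → PolyDeepTraceLaw p → Summit.QuantumFields.YangMills.Theses.LuscherReduction.TwistedTraceScaling

/-- The exponent bookkeeping the composition needs, recorded as a (decidable, true) arithmetic fact for the line's choice
`q = 11/20`, `p = 5`: `1/2 < q` and `p·q < 3` and `3 < p`. -/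
theorem exponents_ok : (1 : ℝ) / 2 < 11 / 20 ∧ (5 : ℝ) * (11 / 20) < 3 ∧ (3 : ℝ) < 5 := by norm_num

end Summit.QuantumFields.YangMills.Cruxes.TwistedTraceScaling.Ideate2g1

end
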